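import Literature.NumberTheory.LFunctions.ExplicitKthDerivTest
import HarnessLib

/-!
# The explicit fourth-derivative test for the logarithmic phase on a block (Patel–Yang, Lemma 3.3 core)

Topic `Literature/NumberTheory/LFunctions`. Patel–Yang 2024, proof of Lemma 3.3: for
`f(x) = -(t/2π) log x` (so `e(f(n)) = n^{-it}`, tree `Literature.NumberTheory.LFunctions.VdC.phaseD t`,
`…e_phaseD_zero`) on a block `(a, b]`, `b ≤ h₃a`, one has `f⁽⁴⁾(x) = 3t/(πx⁴)`, hence
`λ₄ ≤ f⁽⁴⁾ ≤ h₃⁴λ₄` with `λ₄ = 3t/(π(h₃a)⁴)`, and Yang's explicit fourth-derivative test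
(`…kthDerivTest_yang`, `k = 4`, Lemma 1.4 of Patel–Yang) applies with `h = h₃⁴`.
Everything here is PROVED.

## Main results

* `Literature.NumberTheory.LFunctions.VdC.phaseD_four_eq` — `phaseD u 4 y = 6(u/2π)/y⁴`.
* `Literature.NumberTheory.LFunctions.VdC.fourthTest_logPhase` — `‖∑_{a<n≤b} e(f(n))‖ ≤
  A₄(η, h₃⁴) h₃ N λ₄^{1/14} + B₄(η) N^{3/4} λ₄^{-1/14}` in the packaged form
  `yangKRHS η (h₃⁴) 4 N λ₄`, `N = b - a`, `λ₄ = 6(t/2π)/(h₃a)⁴ = 3t/(π(h₃a)⁴)`.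

## References

* D. Patel, A. Yang, *An explicit sub-Weyl bound for `ζ(1/2 + it)`*, J. Number Theory 262 (2024),
  Lemma 3.3 (proof) and Lemma 1.4. [cite: PatelYang2024, Lemma 3.3]
-/

noncomputable section

open Real Set

namespace Literature.NumberTheory.LFunctions
namespace VdC

/-- `phaseD u 4 y = 6(u/2π)/y⁴`. [folklore] -/
theorem phaseD_four_eq (u y : ℝ) : phaseD u 4 y = 6 * (u / (2 * π)) * (y ^ 4)⁻¹ := by
  have h : phaseD u 4 y = u / (2 * π) * (-1) ^ (3 + 1) * (Nat.factorial 3 : ℝ)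
      * y ^ (-((3 : ℤ) + 1)) := phaseD_succ u 3 y
  have hz : y ^ (-((3 : ℤ) + 1)) = (y ^ 4)⁻¹ := by
    rw [show (-((3 : ℤ) + 1)) = -((4 : ℕ) : ℤ) by norm_num, zpow_neg, zpow_natCast]
  have h6 : (Nat.factorial 3 : ℝ) = 6 := by norm_num [Nat.factorial]
  rw [h, hz, h6]
  ring

/-- **The fourth-derivative test for the logarithmic phase on a block** (Patel–Yang, proof of
Lemma 3.3): for `t > 0`, `η > 0`, `h₃ ≥ 1` and integers `1 ≤ a < b` with `b ≤ h₃a`,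
`‖∑_{a<n≤b} e(-(t/2π) log n)‖ ≤ yangKRHS η h₃⁴ 4 (b - a) λ₄`, `λ₄ = 6(t/2π)/(h₃a)⁴`.
[cite: PatelYang2024, Lemma 3.3] -/
theorem fourthTest_logPhase {t η h₃ : ℝ} (ht : 0 < t) (hη : 0 < η) (hh₃ : 1 ≤ h₃) {a b : ℤ}
    (ha : 1 ≤ a) (hab : a < b) (hb : (b : ℝ) ≤ h₃ * a) :
    ‖∑ n ∈ Finset.Ioc a b, e (phaseD t 0 n)‖
      ≤ yangKRHS η (h₃ ^ 4) 4 ((b : ℝ) - a) (6 * (t / (2 * π)) / (h₃ * a) ^ 4) := by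
  have ha0 : (0 : ℝ) < a := by exact_mod_cast (show (0 : ℤ) < a by omega)
  have hK : 0 < t / (2 * π) := by positivity
  have hh0 : 0 < h₃ := by linarith
  have hlam : 0 < 6 * (t / (2 * π)) / (h₃ * a) ^ 4 := by positivity
  have hh4 : 1 ≤ h₃ ^ 4 := one_le_pow₀ hh₃
  refine kthDerivTest_yang hη hh4 (by norm_num : 3 ≤ 4) hab hlam (phaseD_derivFamily t ha0 4) (Or.inl ?_)
  intro y hy
  have hy0 : 0 < y := lt_of_lt_of_le ha0 hy.1
  have hyb : y ≤ h₃ * a := hy.2.trans hb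
  rw [phaseD_four_eq]
  constructor
  · -- `6K/(h₃a)⁴ ≤ 6K/y⁴` from `y ≤ h₃ a`
    rw [div_eq_mul_inv]
    refine mul_le_mul_of_nonneg_left ?_ (by positivity)
    exact inv_anti₀ (by positivity) (pow_le_pow_left₀ hy0.le hyb 4)
  · -- `6K/y⁴ ≤ h₃⁴ · 6K/(h₃a)⁴ = 6K/a⁴` from `a ≤ y`
    have e1 : h₃ ^ 4 * (6 * (t / (2 * π)) / (h₃ * a) ^ 4) = 6 * (t / (2 * π)) * ((a : ℝ) ^ 4)⁻¹ := by
      field_simp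
    rw [e1]
    refine mul_le_mul_of_nonneg_left ?_ (by positivity)
    exact inv_anti₀ (by positivity) (pow_le_pow_left₀ ha0.le hy.1 4)

end VdC
end Literature.NumberTheory.LFunctions
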